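import Summits.QuantumFields.BalabanUV.Beta.D1BFx.DressedMixVertexSplit
import Summits.QuantumFields.BalabanUV.Beta.SymCorrectorMixedSiteGauge
import Summits.QuantumFields.BalabanUV.Beta.WardLocusSecondOrder

/-!
# `BalabanUV.Beta.D1BFx.DressedMixVertexSiteSplit` — road «BF-x», binder row D1, slot (K), PART 24 FILE 2 (H2-mix) COLUMN SIDE UNDER THE SITE-LAW MIXED LETTER
# (leaf-03 g31 OFFER O-1 to leaf-01's lineage ∕ the OWNER; statement-first): the twin of leaf-01 g31's `DressedMixVertexSplit` §3 when the field-slot divergence of the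
# field–multiplier table is LEFT multiplication + ANCHOR (an1's `symSiteWardM`; leaf-03 N-g31-1; the OWNER's `CombMixedSiteLetter`), NOT TT13's commutator `hLM`.
# Under `hMs : divV (κ u ↦ M₂ κ u ρ′ w′) w = ξ′ • ([w = (N:ℤ)•w′ + ϱ] • Mt ρ′ w′ − comp (diagK (legInd ϱ w)) (Mt ρ′ w′))`:
# `wsum χ (divV (κ u ↦ vertexOfM K N (M₂ κ u) ν y′)) = ξ′ • (vertexOfM K N (ρ′ w′ ↦ χ ((N:ℤ)•w′ + ϱ) • Mt ρ′ w′) ν y′ − comp (diagK (χ∘legSite ϱ)) (vertexOfM K N Mt ν y′))`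
# — the column gauge function READ AT THE MULTIPLIER ROOTS (anchor word) minus a LEFT word; hence
# `mixOfK K′ N M₂ μ y ν y′ = mixOfK K N M₂ μ y ν y′ − ξ′ • (vertexOfM K N (ρ′ w′ ↦ χ_{μ,y}((N:ℤ)•w′ + ϱ) • Mt ρ′ w′) ν y′ − comp (diagK (χ_{μ,y}∘legSite ϱ)) (V_Mt ν y′))`.

HONEST DEPENDENCY (cell records, verbatim): «continuum YM on T⁴ ⇐ BetaPertH ∧ nine spine estimates (0/9 proved); BetaPertH ⇐ (D1) ∧ (D4) ∧
CAP+tail; G-an2-4 gates asym, D1 and NE2/3/4.»  HONEST FRAMING (cell contract, verbatim): «discharging `BetaPertH` makes Bałaban's UV stability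
UNCONDITIONAL — a real constructive-QFT result; it is NOT the continuum limit and NOT the Clay problem.»  THIS MODULE is [folklore] `tsum` bookkeeping BY NAME
over leaf-01's `DressedMixVertexSplit` §2 (`divV_sliceVertexM_eq`, `mixOfK_coDressKBmAt_eq_sub`), lit-balaban's `KernelWard.tsum_comm_of_prodBound`, an2's `summable_abs_colM`,
leaf-03's TT19 `vertexOfM_comp_diagK_fixed`; the letter `hMs` is a HYPOTHESIS; instance NOT claimed; no definition, no `def … : Prop`, nothing cited, 0 sorry.
0∕4 row-D1 binders; (J1) ONE OPEN ROW; (K) NOT closed; NOT D1, NEVER «G-an2-4 closed», NOT `BetaPertH`, NOT continuum, NOT Clay.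

ABSOLUTE RULE (cell charter, verbatim): «No internally-minted statement may enter as a cited fact. Every hypothesis is either kernel-proved in
this package or a verbatim quotation of a PUBLISHED theorem with page reference. The manuscript(s) under audit are NOT citable for their own
disputed steps — they are the thing under adjudication; programme-internal (2001/route/tribunal) claims are never citable.»

Unit `b2b-balaban-beta-d1-formalise-leaf-03` (gen 31), 2026-08-23 — typed as an OFFER (the column side is leaf-01's lane).  No existing file touched.
-/

noncomputable section

namespace Summit.QuantumFields.BalabanUV.Beta.D1BFx.DressedMixVertexSiteSplit

open Finset
open scoped BigOperators
open Literature.MathematicalPhysics.QuantumFieldTheory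
open Literature.MathematicalPhysics.QuantumFieldTheory.LatticeForm (quo)
open Literature.MathematicalPhysics.QuantumFieldTheory.Balaban1983to89
open Literature.MathematicalPhysics.QuantumFieldTheory.Balaban1983to89.Beta
open B4ContourShift (supNorm)
open ExpKernelCalculus (MKer Decays comp)
open KernelWard (divV tsum_comm_of_prodBound ProdBound)
open InterLevelTransport (cwsum cwsum_apply)
open AffineAveraging (Site box toSite)
open OneStepResolventKernel (Fib wsum)
open OneStepKernelFamily (colH)
open SecondOrderResponse (colM vertexOfM mixOfK LocStencilFM)
open Summit.QuantumFields.BalabanUV.Beta.BorderedHessian (diagK comp_diagK_left)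
open Summit.QuantumFields.BalabanUV.Beta.AveragingWardRootedStencils (legSite legInd legInd_apply)
open Summit.QuantumFields.BalabanUV.Beta.AxialDressingRooted (coDressKBmAt)
open Summit.QuantumFields.BalabanUV.Beta.AxialProjectorBlockMean (bmGaugeAt)
open Summit.QuantumFields.BalabanUV.Beta.WardLocusSecondOrder (summable_abs_colM)
open Summit.QuantumFields.BalabanUV.Beta.SymCorrectorMixedSiteGauge (vertexOfM_comp_diagK_fixed)
open Summit.QuantumFields.BalabanUV.Beta.D1BFx.DressedVertex2Split (summable_abs_bmGaugeAt)
open Summit.QuantumFields.BalabanUV.Beta.D1BFx.DressedMixVertexSplit (divV_sliceVertexM_eq mixOfK_coDressKBmAt_eq_sub)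

variable {d : ℕ} {N : ℕ} [NeZero N]

/-! ## §1 The weighted sum of the site-law letter through the multiplier vertex: anchor word − left word -/

/-- [folklore] **THE COLUMN GAUGE FUNCTION SUMMED AGAINST THE SITE-LAW LETTER THROUGH THE MULTIPLIER VERTEX** (decaying `K`, absolutely summable weight `χ`, entrywise
bounded partner `Mt`; ONE Fubini by a product majorant `|χ w|·|colM w′|·2|ξ′|B`, then two single-point sums):
`wsum χ (w ↦ vertexOfM K N (ρ′ w′ ↦ ξ′ • ([w = (N:ℤ)•w′ + ϱ] • Mt ρ′ w′ − comp (diagK (legInd ϱ w)) (Mt ρ′ w′))) ν y′)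
 = ξ′ • (vertexOfM K N (ρ′ w′ ↦ χ ((N:ℤ)•w′ + ϱ) • Mt ρ′ w′) ν y′ − comp (diagK (z b ↦ χ (legSite ϱ z b))) (vertexOfM K N Mt ν y′))`. -/
theorem wsum_vertexOfM_siteLetter {K : MKer (d + 1) (Fib d)} (hK : ∃ δ C : ℝ, 0 < δ ∧ 0 ≤ C ∧ Decays K C δ)
    {Mt : Fin (d + 1) → Site (d + 1) → MKer (d + 1) (Fib d)} {B : ℝ} (hMtb : ∀ ρ w p q a e, |Mt ρ w p q a e| ≤ B)
    {χ : Site (d + 1) → ℝ} (hχ : Summable fun u => |χ u|) (ϱ : Site (d + 1)) (ξ' : ℝ) (ν : Fin (d + 1)) (y' : Site (d + 1)) :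
    wsum χ (fun w => vertexOfM K N (fun ρ' w' => ξ' • ((if w = (N : ℤ) • w' + ϱ then (1 : ℝ) else 0) • Mt ρ' w' - comp (diagK (legInd ϱ w)) (Mt ρ' w'))) ν y')
      = ξ' • (vertexOfM K N (fun ρ' w' => χ ((N : ℤ) • w' + ϱ) • Mt ρ' w') ν y' - comp (diagK fun z b => χ (legSite ϱ z b)) (vertexOfM K N Mt ν y')) := by
  classical
  have hB : 0 ≤ B := (abs_nonneg _).trans (hMtb 0 0 0 0 (Sum.inl 0) (Sum.inl 0))
  funext x z a b
  rw [Pi.smul_apply, Pi.smul_apply, Pi.smul_apply, Pi.smul_apply, Pi.sub_apply, Pi.sub_apply, Pi.sub_apply, Pi.sub_apply, comp_diagK_left]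
  simp only [OneStepResolventKernel.wsum, vertexOfM, cwsum_apply, smul_eq_mul]
  -- the entry of the letter term at `(ρ′, w′, w)`
  have eL : ∀ (ρ' : Fin (d + 1)) (w' w : Site (d + 1)),
      (ξ' • ((if w = (N : ℤ) • w' + ϱ then (1 : ℝ) else 0) • Mt ρ' w' - comp (diagK (legInd ϱ w)) (Mt ρ' w'))) x z a b
        = ξ' * (((if w = (N : ℤ) • w' + ϱ then (1 : ℝ) else 0) - (if legSite ϱ x a = w then (1 : ℝ) else 0)) * Mt ρ' w' x z a b) := by
    intro ρ' w' w
    rw [Pi.smul_apply, Pi.smul_apply, Pi.smul_apply, Pi.smul_apply, Pi.sub_apply, Pi.sub_apply, Pi.sub_apply, Pi.sub_apply, comp_diagK_left,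
      Pi.smul_apply, Pi.smul_apply, Pi.smul_apply, Pi.smul_apply, smul_eq_mul, smul_eq_mul, legInd_apply]
    ring
  simp only [eL]
  -- bound for the letter coefficient
  have hcoef : ∀ (w' w : Site (d + 1)), |((if w = (N : ℤ) • w' + ϱ then (1 : ℝ) else 0) - (if legSite ϱ x a = w then (1 : ℝ) else 0))| ≤ 2 := by
    intro w' w; split_ifs <;> norm_num
  -- Step 1: pull `χ w` inside the finite `ρ′`-sum and exchange `Σ'_w` with `Σ_ρ′`
  have hsw : ∀ ρ' : Fin (d + 1), Summable fun w => χ w * ∑' w', colM K N ν y' ρ' w' * (ξ' * (((if w = (N : ℤ) • w' + ϱ then (1 : ℝ) else 0)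
      - (if legSite ϱ x a = w then (1 : ℝ) else 0)) * Mt ρ' w' x z a b)) := by
    intro ρ'
    have hin : ∀ w, |∑' w', colM K N ν y' ρ' w' * (ξ' * (((if w = (N : ℤ) • w' + ϱ then (1 : ℝ) else 0)
        - (if legSite ϱ x a = w then (1 : ℝ) else 0)) * Mt ρ' w' x z a b))| ≤ (∑' w', |colM K N ν y' ρ' w'|) * (|ξ'| * (2 * B)) := by
      intro w
      have hs : Summable fun w' => |colM K N ν y' ρ' w'| * (|ξ'| * (2 * B)) := (summable_abs_colM (N := N) hK ν y' ρ').mul_right _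
      have hle : ∀ w', ‖colM K N ν y' ρ' w' * (ξ' * (((if w = (N : ℤ) • w' + ϱ then (1 : ℝ) else 0)
          - (if legSite ϱ x a = w then (1 : ℝ) else 0)) * Mt ρ' w' x z a b))‖ ≤ |colM K N ν y' ρ' w'| * (|ξ'| * (2 * B)) := by
        intro w'
        rw [Real.norm_eq_abs, abs_mul, abs_mul, abs_mul]
        exact mul_le_mul_of_nonneg_left (mul_le_mul_of_nonneg_left
          (mul_le_mul (hcoef w' w) (hMtb ρ' w' x z a b) (abs_nonneg _) (by norm_num)) (abs_nonneg _)) (abs_nonneg _)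
      exact (tsum_of_norm_bounded hs.hasSum hle).trans (le_of_eq tsum_mul_right)
    refine Summable.of_norm_bounded (hχ.mul_right ((∑' w', |colM K N ν y' ρ' w'|) * (|ξ'| * (2 * B)))) fun w => ?_
    rw [Real.norm_eq_abs, abs_mul]
    exact mul_le_mul_of_nonneg_left (hin w) (abs_nonneg _)
  rw [show (∑' w, χ w * ∑ ρ' : Fin (d + 1), ∑' w', colM K N ν y' ρ' w' * (ξ' * (((if w = (N : ℤ) • w' + ϱ then (1 : ℝ) else 0)
        - (if legSite ϱ x a = w then (1 : ℝ) else 0)) * Mt ρ' w' x z a b)))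
      = ∑' w, ∑ ρ' : Fin (d + 1), χ w * ∑' w', colM K N ν y' ρ' w' * (ξ' * (((if w = (N : ℤ) • w' + ϱ then (1 : ℝ) else 0)
        - (if legSite ϱ x a = w then (1 : ℝ) else 0)) * Mt ρ' w' x z a b)) from tsum_congr fun w => Finset.mul_sum _ _ _,
    Summable.tsum_finsetSum fun ρ' _ => hsw ρ']
  -- Step 2: per `ρ′`, Fubini by a product majorant, then the two single-point sums in `w`
  have key : ∀ ρ' : Fin (d + 1), (∑' w, χ w * ∑' w', colM K N ν y' ρ' w' * (ξ' * (((if w = (N : ℤ) • w' + ϱ then (1 : ℝ) else 0)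
      - (if legSite ϱ x a = w then (1 : ℝ) else 0)) * Mt ρ' w' x z a b)))
      = ξ' * (∑' w', colM K N ν y' ρ' w' * (χ ((N : ℤ) • w' + ϱ) * Mt ρ' w' x z a b) - χ (legSite ϱ x a) * ∑' w', colM K N ν y' ρ' w' * Mt ρ' w' x z a b) := by
    intro ρ'
    have hPB : ProdBound fun w w' => χ w * (colM K N ν y' ρ' w' * (ξ' * (((if w = (N : ℤ) • w' + ϱ then (1 : ℝ) else 0)
        - (if legSite ϱ x a = w then (1 : ℝ) else 0)) * Mt ρ' w' x z a b))) := by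
      refine ⟨fun w => |χ w|, fun w' => |colM K N ν y' ρ' w'| * (|ξ'| * (2 * B)), hχ, (summable_abs_colM (N := N) hK ν y' ρ').mul_right _,
        fun w => abs_nonneg _, fun w' => by positivity, fun w w' => ?_⟩
      rw [abs_mul, abs_mul, abs_mul, abs_mul]
      exact mul_le_mul_of_nonneg_left (mul_le_mul_of_nonneg_left (mul_le_mul_of_nonneg_left
        (mul_le_mul (hcoef w' w) (hMtb ρ' w' x z a b) (abs_nonneg _) (by norm_num)) (abs_nonneg _)) (abs_nonneg _)) (abs_nonneg _)
    rw [show (∑' w, χ w * ∑' w', colM K N ν y' ρ' w' * (ξ' * (((if w = (N : ℤ) • w' + ϱ then (1 : ℝ) else 0)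
          - (if legSite ϱ x a = w then (1 : ℝ) else 0)) * Mt ρ' w' x z a b)))
        = ∑' w, ∑' w', χ w * (colM K N ν y' ρ' w' * (ξ' * (((if w = (N : ℤ) • w' + ϱ then (1 : ℝ) else 0)
          - (if legSite ϱ x a = w then (1 : ℝ) else 0)) * Mt ρ' w' x z a b))) from tsum_congr fun w => (tsum_mul_left).symm,
      tsum_comm_of_prodBound hPB]
    -- the inner `w`-sum is two single-point sums
    have inner : ∀ w', (∑' w, χ w * (colM K N ν y' ρ' w' * (ξ' * (((if w = (N : ℤ) • w' + ϱ then (1 : ℝ) else 0)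
        - (if legSite ϱ x a = w then (1 : ℝ) else 0)) * Mt ρ' w' x z a b))))
        = colM K N ν y' ρ' w' * (ξ' * ((χ ((N : ℤ) • w' + ϱ) - χ (legSite ϱ x a)) * Mt ρ' w' x z a b)) := by
      intro w'
      have e1 : (∑' w, χ w * (if w = (N : ℤ) • w' + ϱ then (1 : ℝ) else 0)) = χ ((N : ℤ) • w' + ϱ) := by
        rw [tsum_eq_single ((N : ℤ) • w' + ϱ) (fun w hw => by rw [if_neg hw, mul_zero])]; simp
      have e2 : (∑' w, χ w * (if legSite ϱ x a = w then (1 : ℝ) else 0)) = χ (legSite ϱ x a) := by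
        rw [tsum_eq_single (legSite ϱ x a) (fun w hw => by rw [if_neg (fun h => hw h.symm), mul_zero])]; simp
      have hs1 : Summable fun w => χ w * (if w = (N : ℤ) • w' + ϱ then (1 : ℝ) else 0) :=
        (hasSum_single ((N : ℤ) • w' + ϱ) (fun w hw => by rw [if_neg hw, mul_zero])).summable
      have hs2 : Summable fun w => χ w * (if legSite ϱ x a = w then (1 : ℝ) else 0) :=
        (hasSum_single (legSite ϱ x a) (fun w hw => by rw [if_neg (fun h => hw h.symm), mul_zero])).summable
      calc (∑' w, χ w * (colM K N ν y' ρ' w' * (ξ' * (((if w = (N : ℤ) • w' + ϱ then (1 : ℝ) else 0)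
              - (if legSite ϱ x a = w then (1 : ℝ) else 0)) * Mt ρ' w' x z a b))))
          = ∑' w, (colM K N ν y' ρ' w' * (ξ' * Mt ρ' w' x z a b)) * (χ w * (if w = (N : ℤ) • w' + ϱ then (1 : ℝ) else 0)
              - χ w * (if legSite ϱ x a = w then (1 : ℝ) else 0)) := tsum_congr fun w => by ring
        _ = (colM K N ν y' ρ' w' * (ξ' * Mt ρ' w' x z a b)) * (χ ((N : ℤ) • w' + ϱ) - χ (legSite ϱ x a)) := by
              rw [tsum_mul_left, hs1.tsum_sub hs2, e1, e2]
        _ = _ := by ring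
    simp only [inner]
    -- split the `w′`-series (both pieces summable: `colM` against bounded families)
    have hχB : ∀ w', |χ ((N : ℤ) • w' + ϱ) * Mt ρ' w' x z a b| ≤ (∑' u, |χ u|) * B := fun w' => by
      rw [abs_mul]
      exact mul_le_mul (hχ.le_tsum _ fun _ _ => abs_nonneg _) (hMtb ρ' w' x z a b) (abs_nonneg _) (tsum_nonneg fun _ => abs_nonneg _)
    have s1 : Summable fun w' => colM K N ν y' ρ' w' * (χ ((N : ℤ) • w' + ϱ) * Mt ρ' w' x z a b) :=
      SecondOrderSplitDecay.summable_colM_mul_bdd (N := N) hK hχB ν y' ρ'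
    have s2 : Summable fun w' => colM K N ν y' ρ' w' * Mt ρ' w' x z a b :=
      SecondOrderSplitDecay.summable_colM_mul_bdd (N := N) hK (fun w' => hMtb ρ' w' x z a b) ν y' ρ'
    calc (∑' w', colM K N ν y' ρ' w' * (ξ' * ((χ ((N : ℤ) • w' + ϱ) - χ (legSite ϱ x a)) * Mt ρ' w' x z a b)))
        = ∑' w', (ξ' * (colM K N ν y' ρ' w' * (χ ((N : ℤ) • w' + ϱ) * Mt ρ' w' x z a b))
            - (ξ' * χ (legSite ϱ x a)) * (colM K N ν y' ρ' w' * Mt ρ' w' x z a b)) := tsum_congr fun w' => by ring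
      _ = ξ' * (∑' w', colM K N ν y' ρ' w' * (χ ((N : ℤ) • w' + ϱ) * Mt ρ' w' x z a b))
            - (ξ' * χ (legSite ϱ x a)) * ∑' w', colM K N ν y' ρ' w' * Mt ρ' w' x z a b := by
          rw [(s1.mul_left ξ').tsum_sub (s2.mul_left _), tsum_mul_left, tsum_mul_left]
      _ = _ := by ring
  simp only [key]
  rw [← Finset.mul_sum, Finset.sum_sub_distrib, ← Finset.mul_sum]
  simp only [Pi.smul_apply, smul_eq_mul]

/-! ## §2 The dressed mixed bi-vertex under the site-law letter: raw word − ξ′·(ANCHOR word − LEFT word) -/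

section SiteLetter

variable (hN : 1 ≤ N) {r : Fin (d + 1) → ℕ} (hr : r ∈ box (d + 1) N) {K : MKer (d + 1) (Fib d)} (hK : ∃ δ C : ℝ, 0 < δ ∧ 0 ≤ C ∧ Decays K C δ)
  {M₂ : Fin (d + 1) → Site (d + 1) → Fin (d + 1) → Site (d + 1) → MKer (d + 1) (Fib d)} {C₂ δ₂ : ℝ} (hM₂ : LocStencilFM N M₂ C₂ δ₂) (hδ₂ : 0 < δ₂)
  (μ : Fin (d + 1)) (y : Site (d + 1)) (ν : Fin (d + 1)) (y' : Site (d + 1)) {M c : ℝ} (hM : 0 ≤ M) (hc : 0 < c)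
  (hKμ : ∀ κ u, |colH K N μ y κ u| ≤ M * Real.exp (-(c * supNorm (quo N u - y))))
  {Mt : Fin (d + 1) → Site (d + 1) → MKer (d + 1) (Fib d)} {B : ℝ} (hMtb : ∀ ρ w p q a e, |Mt ρ w p q a e| ≤ B) {ϱ : Site (d + 1)} {ξ' : ℝ}
  (hMs : ∀ ρ' w' w, divV (fun κ u => M₂ κ u ρ' w') w
    = ξ' • ((if w = (N : ℤ) • w' + ϱ then (1 : ℝ) else 0) • Mt ρ' w' - comp (diagK (legInd ϱ w)) (Mt ρ' w')))
include hN hr hK hM₂ hδ₂ hM hc hKμ hMtb hMs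

/-- [folklore] **THE DRESSED MIXED BI-VERTEX UNDER THE SITE-LAW LETTER**: with `χ := bmGaugeAt (toSite r) (colH K N μ y) N` (the packing column's gauge function),
`mixOfK K′ N M₂ μ y ν y′ = mixOfK K N M₂ μ y ν y′ − ξ′ • (vertexOfM K N (ρ′ w′ ↦ χ ((N:ℤ)•w′ + ϱ) • Mt ρ′ w′) ν y′ − comp (diagK (χ∘legSite ϱ)) (vertexOfM K N Mt ν y′))`
— leaf-01's letter-free split (`mixOfK_coDressKBmAt_eq_sub`, `divV_sliceVertexM_eq`) + §1: the column twin of TT19's face-side word (ANCHOR = the gauge function READ AT THE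
MULTIPLIER ROOTS, LEFT = the gauge generator acting on the row legs of `V_Mt`). -/
theorem mixOfK_coDressKBmAt_eq_of_siteLetter :
    mixOfK (coDressKBmAt (toSite r) N K) N M₂ μ y ν y'
      = mixOfK K N M₂ μ y ν y'
        - ξ' • (vertexOfM K N (fun ρ' w' => bmGaugeAt (toSite r) (colH K N μ y) N ((N : ℤ) • w' + ϱ) • Mt ρ' w') ν y'
          - comp (diagK fun z b => bmGaugeAt (toSite r) (colH K N μ y) N (legSite ϱ z b)) (vertexOfM K N Mt ν y')) := by
  rw [mixOfK_coDressKBmAt_eq_sub hN hr hK hM₂ hδ₂ μ y ν y' hM hc hKμ]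
  have e : (divV fun κ u => vertexOfM K N (M₂ κ u) ν y')
      = fun w => vertexOfM K N (fun ρ' w' => ξ' • ((if w = (N : ℤ) • w' + ϱ then (1 : ℝ) else 0) • Mt ρ' w' - comp (diagK (legInd ϱ w)) (Mt ρ' w'))) ν y' := by
    funext w
    rw [divV_sliceVertexM_eq hK hM₂ hδ₂ ν y' w]
    have e' : (fun ρ' w' => divV (fun κ u => M₂ κ u ρ' w') w)
        = fun ρ' w' => ξ' • ((if w = (N : ℤ) • w' + ϱ then (1 : ℝ) else 0) • Mt ρ' w' - comp (diagK (legInd ϱ w)) (Mt ρ' w')) :=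
      funext fun ρ' => funext fun w' => hMs ρ' w' w
    rw [e']
  rw [e, wsum_vertexOfM_siteLetter hK hMtb (summable_abs_bmGaugeAt hN hr K μ y hM hc hKμ) ϱ ξ' ν y']

end SiteLetter

end Summit.QuantumFields.BalabanUV.Beta.D1BFx.DressedMixVertexSiteSplit

end
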